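import Summits.AtomisticToContinuum.FouriersLaw.Theorems.LocalOhmBVBVProfileBoundarySeam
import Summits.AtomisticToContinuum.FouriersLaw.Theorems.PuiseuxTransferLedgerTwoModeBulkReduction

/-!
# Stub `stub_boundaryBound` of line `registered` (crux `LocalOhmBV.BVProfile`, item stmt-AtomisticToContinuum-12012)
# in its pure equilibrium (cut-bond) form

The registered stub `stub_boundaryBound` asks, for `pinnedChain ω₂ lam β γ` (all `> 0`), under weak-NESS uniqueness and
along any steady-state family, for every `T > 0` and EVERY boundary-layer width `ℓ`, for an `N`-UNIFORM constant `B`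
with `|t| ≤ B` for every `N`, every site `i : Fin N` within `ℓ + 1` of an end (`i ≤ ℓ ∨ N ≤ i + 1 + ℓ`) and every limit
`t` of the kinetic-temperature response difference quotient `δ ↦ (μ_{N,T+δ/2,T−δ/2}(p_i²) − μ_{N,T,T}(p_i²))/δ` along
`𝓝[≠] 0`.

The tree identifies the profile at fixed `N` (`TwoModeBulk.Sketch.tendsto_profileValue`): for the `(N+1)`-site chain
the response limit at site `i` IS the cut-bond value `u_N(i) = (γ/T²)∫₀^∞ Y_i − 1/2`,
`Y_i(t) = Cov_{Gibbs_T}(p_0², K_t p_i²)` (`K_t = transitionKernel (N+1) T T t`). Hence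
(`stub_boundaryBound_iff_cutBondBoundaryBound`) the stub is EQUIVALENT to the same boundary-layer bound for the explicit
equilibrium profiles `u_N` — no NESS, no `δ → 0` limit, no uniqueness hypothesis and no family left in it:
(→) run the stub along a steady family chosen from `pinnedChain_exists_isSteadyState` (`exists_steadyFamily`) at the
proved uniqueness `NessUnique_holds`; (←) limits along `𝓝[≠] 0` are unique, so every limit `t` IS `u_N(i)`; `N = 0`
sites is vacuous. No definitions, no named facts, no sorry; standard axioms. [folklore]
-/

noncomputable section

open MeasureTheory Filter Topology Set

namespace Summit.AtomisticToContinuum.FouriersLaw.Theorems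

open Literature.MathematicalPhysics.KineticTheory.HeatConduction
open Summit.AtomisticToContinuum.FouriersLaw.Theorems.BoundaryKubo.Negative.LoadBearing (UniqueSteady SteadyFamily)
open Summit.AtomisticToContinuum.FouriersLaw.Theorems.TwoModeBulk.Sketch (tendsto_profileValue exists_steadyFamily)

/-- **The stub `stub_boundaryBound` is EQUIVALENT to an `N`-uniform boundary-layer bound on ONE explicit equilibrium
profile** (lossless reduction, no NESS / uniqueness / family left in it). With `u_N(i) = (γ/T²)∫₀^∞ Y_i − 1/2`,
`Y_i(t) = Cov_{Gibbs_T}(p_0², K_t p_i²)` for the `(N+1)`-site equilibrium chain (`K_t = transitionKernel (N+1) T T t`):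
the stub holds iff for all admissible parameters, `T > 0` and every width `ℓ` there is `B` with `|u_N(i)| ≤ B` for
every `N` and every `i : Fin (N+1)` with `i ≤ ℓ ∨ N + 1 ≤ i + 1 + ℓ`. (→): run the stub along a steady family chosen
from `pinnedChain_exists_isSteadyState` (`TwoModeBulk.Sketch.exists_steadyFamily`) at the proved uniqueness
`NessUnique_holds`; the quotient at `i` tends to `u_N(i)` (`tendsto_profileValue`). (←): limits along `𝓝[≠] 0` are
unique, so every limit `t` IS `u_N(i)`; `N = 0` sites is vacuous. [folklore] -/
theorem stub_boundaryBound_iff_cutBondBoundaryBound : (∀ ω₂ lam β γ : ℝ, 0 < ω₂ → 0 < lam → 0 < β → 0 < γ → (∀ (N : ℕ) (T_L T_R : ℝ), 0 < T_L → 0 < T_R → ∀ μ ν : MeasureTheory.Measure (Literature.MathematicalPhysics.KineticTheory.HeatConduction.PhaseSpace N), (Literature.MathematicalPhysics.KineticTheory.HeatConduction.pinnedChain ω₂ lam β γ).IsSteadyState N T_L T_R μ → (Literature.MathematicalPhysics.KineticTheory.HeatConduction.pinnedChain ω₂ lam β γ).IsSteadyState N T_L T_R ν → μ = ν) → ∀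 μ : (N : ℕ) → ℝ → ℝ → MeasureTheory.Measure (Literature.MathematicalPhysics.KineticTheory.HeatConduction.PhaseSpace N), (∀ (N : ℕ) (T_L T_R : ℝ), 0 < T_L → 0 < T_R → (Literature.MathematicalPhysics.KineticTheory.HeatConduction.pinnedChain ω₂ lam β γ).IsSteadyState N T_L T_R (μ N T_L T_R)) → ∀ T : ℝ, 0 < T → ∀ ℓ : ℕ, ∃ B : ℝ, ∀ (N : ℕ) (i : Fin N) (t : ℝ), (i.val ≤ ℓ ∨ N ≤ i.val + 1 + ℓ) → Filter.Tendsto (fun δ : ℝ => ((∫ x, (x.2 i) ^ 2 ∂(μ N (T + δ / 2) (T - δ / 2))) - ∫ x, (x.2 i) ^ 2 ∂(μ N T T)) / δ) (nhdsWithin 0 {(0 : ℝ)}ᶜ) (nhds t) → |t| ≤ B) ↔ (∀ ω₂ lam β γ : ℝ, 0 < ω₂ → 0 < lam → 0 < β → 0 < γ → ∀ T : ℝ, 0 < T → ∀ ℓ : ℕ, ∃ B : ℝ, ∀ (N : ℕ) (i : Fin (N + 1)), (i.val ≤ ℓ ∨ N + 1 ≤ i.val + 1 + ℓ) → |γ /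 T ^ 2 * (∫ t in Set.Ioi (0 : ℝ), ((∫ z, (z.2 0) ^ 2 * (∫ y, (y.2 i) ^ 2 ∂((Literature.MathematicalPhysics.KineticTheory.HeatConduction.pinnedChain ω₂ lam β γ).transitionKernel (N + 1) T T t.toNNReal z)) ∂((Literature.MathematicalPhysics.KineticTheory.HeatConduction.pinnedChain ω₂ lam β γ).gibbsMeasure (N + 1) T)) - (∫ z, (z.2 0) ^ 2 ∂((Literature.MathematicalPhysics.KineticTheory.HeatConduction.pinnedChain ω₂ lam β γ).gibbsMeasure (N + 1) T)) * (∫ z, (∫ y, (y.2 i) ^ 2 ∂((Literature.MathematicalPhysics.KineticTheory.HeatConduction.pinnedChain ω₂ lam β γ).transitionKernel (N + 1) T T t.toNNReal z)) ∂((Literature.MathematicalPhysics.KineticTheory.HeatConduction.pinnedChain ω₂ lam β γ).gibbsMeasure (N + 1) T)))) - 1 / 2| ≤ B) := by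
  constructor
  · -- (→): the stub along a chosen steady family at the proved uniqueness, with the identified limits
    intro h ω₂ lam β γ hω hl hβ hγ T hT ℓ
    have hU : UniqueSteady ω₂ lam β γ :=
      Summit.AtomisticToContinuum.FouriersLaw.Theses.TransferKernelPositivity.NessUnique_holds ω₂ lam β γ hω hl hβ hγ
    obtain ⟨μ, hμ⟩ := exists_steadyFamily hω hl hβ hγ
    obtain ⟨B, hB⟩ := h ω₂ lam β γ hω hl hβ hγ hU μ hμ T hT ℓ
    exact ⟨B, fun N i hi => hB (N + 1) i _ hi (tendsto_profileValue hω hl hβ hγ hU hμ hT N i)⟩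
  · -- (←): any limit along `𝓝[≠] 0` is the cut-bond value
    intro h ω₂ lam β γ hω hl hβ hγ huniq μ hμ T hT ℓ
    have hU : UniqueSteady ω₂ lam β γ := huniq
    have hfam : SteadyFamily ω₂ lam β γ μ := hμ
    obtain ⟨B, hB⟩ := h ω₂ lam β γ hω hl hβ hγ T hT ℓ
    refine ⟨B, fun N i t hi ht => ?_⟩
    cases N with
    | zero => exact i.elim0
    | succ M =>
      rw [tendsto_nhds_unique ht (tendsto_profileValue hω hl hβ hγ hU hfam hT M i)]
      exact hB M i hi

end Summit.AtomisticToContinuum.FouriersLaw.Theorems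

end
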